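import Summits.QuantumFields.YangMills.Theorems.UnitScaleTiltProp7LocalAxialGaugeSmallField
import Summits.QuantumFields.YangMills.Theorems.UnitScaleTiltProp7GaugeCovariancePointwise
import HarnessLib

/-!
# Route `UnitScaleTilt`, crux K1 «MinimiserStabilityRegPr» (stmt-QuantumFields-19200), EX row (5) `h3` (STOREY H), H-ROAD pipeline (ii) H2-LOC — THE DOOR `hWsup ⟸ hHlocV + (A-ROW)`:
# **THE SUP OF THE MASSIVE RESOLVENT ON DIVERGENCE DATA AT A PRINTED-REGULAR BACKGROUND FROM THE CURVED INTERIOR η-½-HÖLDER LETTER AND THE AGMON `L²` ROW**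
# (★CHAIR WORD №60 (2)(4), №62; cst-p1 g38 LOCATE `LOCATE-hWsup-supplier-cstp1g38.md` c1d4da4e §1 (a)(b)(c)(e)(f); px19 g16 frozen letter texts `H2LOC-LETTER-hWsup.px19g16.txt`
# a03f6c184c689677 and `H2LOC-LETTER-hHlocV.px19g16.txt` 857ccd79b0071bdc, consumed TOKEN FOR TOKEN).  Cell `ym3-torus` (HUMAN RULING D-0037; rung R3 = SU(2) YM₃ on T³ — NOT
# d = 4, NOT infinite volume, NOT a mass gap, NOT Clay).  Width seat `ym3-torus-px5` (gen 16); `--supports stmt-QuantumFields-19200 --as helper`; count-neutral; 0 `def`, 0 `sorry`.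

THE MATHEMATICS ([Balaban1985BackgroundPropagators] Thm 3.1, the sup bound (3.46) for `G D*`-type operators at a regular background; here for `w = (Δ^η_{U₀} + 1)⁻¹ D*_{U₀} x` at a
member of the T³ family).  `M := max_y ‖w(y)‖` attained at `y₀`, `X := sup_b ‖x(b)‖`.  (a) LIFT to the `L³`-fold cover `F.cover 3` (✓`covLapSite_cover`, ✓`DstarL2_cover'`,
✓`regPr_cover_iff`, room ✓`room_cover_three`).  (b) LOCAL GAUGE at a lift `ct` of `y₀`: in the cover's axial gauge the background `Ṽ` has `‖Ṽ(z, μ) − 1‖ ≤ 48ε₀η` on the `12ℓ+4` ball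
(✓`norm_bgOfCfg_gaugeAct_axialT_sub_one_le_cover`); the conjugation isometries (✓`exists_adIsometries_pointwise`) preserve pointwise norms and transport the equation
(✓`memberEquation_gaugeAct`).  (c) `hHlocV` at `(Mu, Mf, Mq, δ) := (M, X, M, 48ε₀η)` (`ℓδ = 48ε₀ ≤ θ₀` iff `ε₀ ≤ θ₀∕48`): `‖ũ(x′)‖ ≥ M − (2M + X)∕8` on the ball of radius
`r := ℓ∕(8Ch+1)²`.  (d) (A-ROW) `Σ_{tdist ≤ ℓ} ‖ũ‖² ≤ C_A·ℓ³·X²` (any background; cst-p1 g38's `…MassiveDivergenceAgmonRow`, here the displayed hypothesis `hArow`).  (e) BALL COUNT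
(§1): `r³ ≤ #{y : tdist ct y ≤ r}` for `r + 1 ≤ period`.  (f) BOOTSTRAP: `6M ≤ X` or `r³(M − (2M+X)∕8)² ≤ C_Aℓ³X²`, whence **`M ≤ (2(8Ch+1)³√C_A + 1)·X`** — K-FREE (p. 399 L1–3).

WHAT IS PROVED (ns `Summit.QuantumFields.YangMills.Theorems.Prop7MassiveDivergenceSupDoor`).
* §1 ★ `succ_pow_le_card_ball` ∕ ★ `pow_le_card_ball` — on the [B9] torus `TSite d P`: `(R+1)^d ≤ #{y : tdist x y ≤ R}` for `R + 1 ≤ P i`; `r^d ≤ #{y : tdist x y ≤ r}` for `r + 1 ≤ P i`.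
* §2 ★★ `sup_le_of_holder_agmon` — THE BOOTSTRAP at one member from the two letters AT THIS MEMBER (maximal site `x₀`, `δ`-row on the `4ℓ+1` ball, room `ℓ + 1 ≤ period`).
* §3 ★★ `exists_cover_gauge_lift` — THE LIFT-AND-GAUGE PACKAGE: `(Ṽ, ũ, f̃, x̃₀)` on `F.cover 3` with the same equation, pointwise norms among those of `(w, x)`, `‖ũ(x̃₀)‖ = ‖w(y₀)‖`,
  and the δ-row `48ε₀η` on the `12ℓ+4` ball about `x̃₀`.
* §4 ★★★ **`hWsup_of_hHlocV`** — THE DOOR: `0 ≤ Ch → 0 < θ₀ → 0 ≤ C_A → ⟨hHlocV Ch θ₀⟩ → ⟨hArow C_A⟩ → ∃ Cw θw, 0 ≤ Cw ∧ 0 < θw ∧ ⟨hWsup Cw θw⟩` with the letter texts VERBATIM,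
  witnesses `Cw := 2(8Ch+1)³√C_A + 1`, `θw := θ₀∕48` displayed in the proof's first line.
HYP-SAT (★★OWNER RULING №42).  `hHlocV` is TRUE for arbitrary `V` (interior estimate; flat case inhabited by ✓`exists_localHolder_flat_member`), supplied by px19's (C1)–(C5); `hArow` is
cst-p1 g38's (A-ROW) (Agmon∕Combes–Thomas from the mass term, any background); both are real-inequality schemas and neither restates the conclusion (a GLOBAL sup at a `RegPr`
background vs a LOCAL modulus and a LOCAL `L²` mass bound).  `RegPr` is the EX face's standing hypothesis (inhabited at `U₀ = 1`).  At `w = 0, x = 0` both sides read `0 ≤ Cw·X`.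
HONEST SCOPE.  A knit over landed rows (px12's cover pullback, px10's covariance glue, px13's local axial gauge, px5 g15's room lemma); the two analytic letters stay HYPOTHESES here;
nothing of `hHlocV`, (A-ROW), H2 FILE 2, `h3`, norm_G, EX, 19200 or the rung is proved; the Yang–Mills mass gap is NOT proved.

References: T. Bałaban, CMP **99** (1985) 389–434 [Balaban1985BackgroundPropagators] (Thm 3.1 (3.42)–(3.47) pp.397–399, p.399 L1–3, (3.35) p.396, (3.23) p.394, (3.11) p.392);
CMP **96** (1984) 223–250 [Balaban1984PropagatorsII] (Lemma 2.1 (2.61)–(2.63) p.234); CMP **98** (1985) 17–51 [Balaban1985Averaging] (pp.24–25); CMP **109** (1987) 249–301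
[Balaban1987RG1] ((0.1)–(0.3) pp.251–252).
-/

set_option autoImplicit false

noncomputable section

open scoped InnerProductSpace ComplexConjugate BigOperators Matrix.Norms.L2Operator

namespace Summit.QuantumFields.YangMills.Theorems.Prop7MassiveDivergenceSupDoor

open Literature.MathematicalPhysics.QuantumFieldTheory.Balaban1983to89
open Literature.MathematicalPhysics.QuantumFieldTheory.Balaban1983to89.T3ContinuumYM3Torus
open B4TorusKernel.MultiPeriod (circAbs circAbs_add_mul circAbs_le_abs)
open B4Sect5Torus (TSite tdist ccoord tdist_nonneg)
open B9SectCLatticeCarrier (Bond)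
open B9Eq311L2Pairing (WL2)
open B11Eq103H1Complex (SiteL2K BondL2K)
open B10Eq27TorusAxialLog (axialT)
open T3PrintedRegularMinimiser (RegPr)
open T3SectALandauChart (eta eta_pos)
open Summit.QuantumFields.YangMills.Theorems.Prop7SectET3Transport (periodsT3 siteEquiv bondEquiv bgOfCfg)
open Summit.QuantumFields.YangMills.Theorems.Prop7SectET3HilbertLetters (W₂ toL2 toL2S DstarL2 covLapSite toL2_apply toL2S_apply)
open Summit.QuantumFields.YangMills.Theorems.CoverSites
open Summit.QuantumFields.YangMills.Theorems.Prop7CoverHilbertPullback (covLapSite_cover DstarL2_cover')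
open Summit.QuantumFields.YangMills.Theorems.Prop7GaugeCovariancePointwise (exists_adIsometries_pointwise memberEquation_gaugeAct)
open Summit.QuantumFields.YangMills.Theorems.Prop7LocalAxialGaugeSmallField (norm_bgOfCfg_gaugeAct_axialT_sub_one_le_cover)
open Summit.QuantumFields.YangMills.Theorems.Prop7PoissonGradientDecayAllMembers (tdist_siteEquiv_proj_le room_cover_three)
open Summit.QuantumFields.YangMills.Theorems.SmallMembersCoverLift (regPr_cover_iff)

/-! ## §1 The ball count on the [B9] torus -/

/-- ★ **A BALL OF THE SUP-DISTANCE CONTAINS A CORNER CUBE**: for `R + 1 ≤ P i` in every direction, `(R+1)^d ≤ #{y : tdist P x y ≤ R}` — the cube `x + [0, R]^d` injects into the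
torus (no wrap below the period) and each of its points is within circular distance `R` of `x` coordinatewise. [folklore] [cite: Balaban1984PropagatorsI, (1.110) p.35] -/
theorem succ_pow_le_card_ball {d : ℕ} {P : Fin d → ℕ} (x : TSite d P) (R : ℕ) (hR : ∀ i, R + 1 ≤ P i) :
    (R + 1) ^ d ≤ (Finset.univ.filter (fun y : TSite d P => tdist P x y ≤ (R : ℝ))).card := by
  classical
  have hP0 : ∀ i, 0 < P i := fun i => by have := hR i; omega
  -- the corner cube `x + [0, R]^d`
  let φ : (Fin d → Fin (R + 1)) → TSite d P := fun v i => ⟨((x i).val + (v i).val) % P i, Nat.mod_lt _ (hP0 i)⟩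
  have hφ : ∀ v i, ((φ v) i).val = ((x i).val + (v i).val) % P i := fun v i => rfl
  have hφinj : Function.Injective φ := by
    intro v v' h
    funext i
    have hi : ((x i).val + (v i).val) % P i = ((x i).val + (v' i).val) % P i := by
      rw [← hφ v i, ← hφ v' i, h]
    apply Fin.ext
    have hv : (v i).val < P i := lt_of_lt_of_le (v i).isLt (hR i)
    have hv' : (v' i).val < P i := lt_of_lt_of_le (v' i).isLt (hR i)
    have hmod : (v i).val % P i = (v' i).val % P i := Nat.ModEq.add_left_cancel' (x i).val hi
    rwa [Nat.mod_eq_of_lt hv, Nat.mod_eq_of_lt hv'] at hmod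
  have hφball : ∀ v, φ v ∈ Finset.univ.filter (fun y : TSite d P => tdist P x y ≤ (R : ℝ)) := by
    intro v
    rw [Finset.mem_filter]
    refine ⟨Finset.mem_univ _, ?_⟩
    unfold tdist
    have hsup : Finset.univ.sup (ccoord P x (φ v)) ≤ R := by
      refine Finset.sup_le fun i _ => ?_
      unfold ccoord
      rw [Int.toNat_le, hφ v i, Int.natCast_mod, Nat.cast_add, Int.emod_def]
      have hrw : ((x i).val : ℤ) - (((x i).val : ℤ) + ((v i).val : ℤ) - (P i : ℤ) * ((((x i).val : ℤ) + ((v i).val : ℤ)) / (P i : ℤ)))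
          = -((v i).val : ℤ) + (P i : ℤ) * ((((x i).val : ℤ) + ((v i).val : ℤ)) / (P i : ℤ)) := by ring
      rw [hrw, circAbs_add_mul]
      calc circAbs (P i) (-((v i).val : ℤ)) ≤ |(-((v i).val : ℤ))| := circAbs_le_abs (hP0 i) _
        _ = ((v i).val : ℤ) := by rw [abs_neg, abs_of_nonneg (by positivity)]
        _ ≤ (R : ℤ) := by have := (v i).isLt; omega
    exact_mod_cast hsup
  calc (R + 1) ^ d = Fintype.card (Fin d → Fin (R + 1)) := by simp
    _ = (Finset.univ.image φ).card := (Finset.card_image_of_injective _ hφinj).symm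
    _ ≤ _ := Finset.card_le_card fun y hy => by
        obtain ⟨v, -, rfl⟩ := Finset.mem_image.mp hy
        exact hφball v

/-- ★ **THE BALL COUNT, REAL RADIUS**: for `0 ≤ r` with `r + 1 ≤ P i` in every direction, `r^d ≤ #{y : tdist P x y ≤ r}` (`R := ⌊r⌋`, `r < R + 1`, §1 at `R`).
[folklore] [cite: Balaban1984PropagatorsI, (1.110) p.35] -/
theorem pow_le_card_ball {d : ℕ} {P : Fin d → ℕ} (x : TSite d P) {r : ℝ} (hr : 0 ≤ r) (hrP : ∀ i, r + 1 ≤ (P i : ℝ)) :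
    r ^ d ≤ ((Finset.univ.filter (fun y : TSite d P => tdist P x y ≤ r)).card : ℝ) := by
  classical
  set R : ℕ := ⌊r⌋₊ with hRdef
  have hRr : (R : ℝ) ≤ r := Nat.floor_le hr
  have hrR : r < (R : ℝ) + 1 := Nat.lt_floor_add_one r
  have hRP : ∀ i, R + 1 ≤ P i := fun i => by
    have h1 : ((R + 1 : ℕ) : ℝ) ≤ (P i : ℝ) := by push_cast; linarith [hrP i]
    exact_mod_cast h1
  have hmono : (Finset.univ.filter (fun y : TSite d P => tdist P x y ≤ (R : ℝ))).card
      ≤ (Finset.univ.filter (fun y : TSite d P => tdist P x y ≤ r)).card :=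
    Finset.card_le_card (Finset.monotone_filter_right _ fun y _ hy => hy.trans hRr)
  calc r ^ d ≤ ((R : ℝ) + 1) ^ d := pow_le_pow_left₀ hr hrR.le d
    _ = (((R + 1) ^ d : ℕ) : ℝ) := by push_cast; ring
    _ ≤ ((Finset.univ.filter (fun y : TSite d P => tdist P x y ≤ (R : ℝ))).card : ℝ) := by exact_mod_cast succ_pow_le_card_ball x R hRP
    _ ≤ _ := by exact_mod_cast hmono

/-! ## §2 The bootstrap at one member -/

section Bootstrap

variable (F : T3Family) (n K : ℕ) (c₀ : ℝ) [Fact (0 < c₀)]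

/-- ★★ **THE BOOTSTRAP** ([Balaban1985BackgroundPropagators] Thm 3.1 (3.46), sup of the massive resolvent on divergence data; LOCATE c1d4da4e §1 (c)(e)(f)).  At ONE member, from the
curved interior η-½-Hölder letter `hH` (px19 `hHlocV` AT THIS MEMBER) and the Agmon `L²` row `hA` (cst-p1 (A-ROW) AT THIS MEMBER): a solution `u` of `Δ^η_V u + 1•u = D*_V f` with
`‖u(y)‖ ≤ M = ‖u(x₀)‖` everywhere, `‖f(p)‖ ≤ X`, a `δ`-row `‖V(y, μ) − 1‖ ≤ δ` on the `4ℓ+1` ball about `x₀` with `ℓδ ≤ θ₀`, and the room `ℓ + 1 ≤ period`, obeys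
`M ≤ (2(8Ch+1)³√C_A + 1)·X`.  PROOF: `hH` gives `‖u(y)‖ ≥ M − (2M+X)∕8` on the ball of radius `r = ℓ∕(8Ch+1)²`; `hA` and §1 give `r³(M − (2M+X)∕8)² ≤ C_Aℓ³X²` unless `6M ≤ X`.
[cite: Balaban1985BackgroundPropagators, Thm 3.1 (3.46) p.398, p.399 L1-3; Balaban1984PropagatorsII, Lemma 2.1 (2.61)-(2.63) p.234] -/
theorem sup_le_of_holder_agmon (Ch θ₀ C_A : ℝ) (hCh : 0 ≤ Ch) (hCA : 0 ≤ C_A)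
    (hH : ∀ (V : GaugeField (F.P K) 0 (Matrix.specialUnitaryGroup (Fin 2) ℂ))
      (u q : SiteL2K ℂ 3 (periodsT3 F K) c₀ W₂) (f : BondL2K ℂ 3 (periodsT3 F K) c₀ W₂) (x : TSite 3 (periodsT3 F K)) (Mu Mf Mq δ : ℝ),
      0 ≤ Mu → 0 ≤ Mf → 0 ≤ Mq → 0 ≤ δ → (F.L : ℝ) ^ (K - n) * δ ≤ θ₀ →
      covLapSite F n K c₀ V u + q = DstarL2 F n K c₀ V f →
      (∀ y, tdist (periodsT3 F K) x y ≤ 4 * (F.L : ℝ) ^ (K - n) + 1 → ‖WL2.equiv ℂ (fun _ : TSite 3 (periodsT3 F K) => c₀) W₂ u y‖ ≤ Mu) →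
      (∀ (y : TSite 3 (periodsT3 F K)) (μ : Fin 3), tdist (periodsT3 F K) x y ≤ 4 * (F.L : ℝ) ^ (K - n) + 1 →
        ‖WL2.equiv ℂ (fun _ : Bond 3 (periodsT3 F K) => c₀) W₂ f (y, μ)‖ ≤ Mf) →
      (∀ y, tdist (periodsT3 F K) x y ≤ 4 * (F.L : ℝ) ^ (K - n) + 1 → ‖WL2.equiv ℂ (fun _ : TSite 3 (periodsT3 F K) => c₀) W₂ q y‖ ≤ Mq) →
      (∀ (y : TSite 3 (periodsT3 F K)) (μ : Fin 3), tdist (periodsT3 F K) x y ≤ 4 * (F.L : ℝ) ^ (K - n) + 1 →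
        ‖((bgOfCfg F K V (y, μ) : (Matrix (Fin 2) (Fin 2) ℂ)ˣ) : Matrix (Fin 2) (Fin 2) ℂ) - 1‖ ≤ δ) →
      ∀ x' : TSite 3 (periodsT3 F K), tdist (periodsT3 F K) x x' ≤ (F.L : ℝ) ^ (K - n) →
        ‖WL2.equiv ℂ (fun _ : TSite 3 (periodsT3 F K) => c₀) W₂ u x' - WL2.equiv ℂ (fun _ : TSite 3 (periodsT3 F K) => c₀) W₂ u x‖
          ≤ Ch * (Mu + Mf + Mq) * (tdist (periodsT3 F K) x x' / ((F.L : ℝ) ^ (K - n))) ^ ((1 : ℝ) / 2))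
    (hA : ∀ (V : GaugeField (F.P K) 0 (Matrix.specialUnitaryGroup (Fin 2) ℂ))
      (w : SiteL2K ℂ 3 (periodsT3 F K) c₀ W₂) (x : BondL2K ℂ 3 (periodsT3 F K) c₀ W₂) (X : ℝ),
      covLapSite F n K c₀ V w + ((1 : ℝ) : ℂ) • w = DstarL2 F n K c₀ V x →
      (∀ b, ‖WL2.equiv ℂ (fun _ : Bond 3 (periodsT3 F K) => c₀) W₂ x b‖ ≤ X) →
      ∀ y₀ : TSite 3 (periodsT3 F K),
        ∑ y ∈ Finset.univ.filter (fun y => tdist (periodsT3 F K) y₀ y ≤ (F.L : ℝ) ^ (K - n)),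
          ‖WL2.equiv ℂ (fun _ : TSite 3 (periodsT3 F K) => c₀) W₂ w y‖ ^ 2 ≤ C_A * ((F.L : ℝ) ^ (K - n)) ^ 3 * X ^ 2)
    (V : GaugeField (F.P K) 0 (Matrix.specialUnitaryGroup (Fin 2) ℂ)) (u : SiteL2K ℂ 3 (periodsT3 F K) c₀ W₂) (f : BondL2K ℂ 3 (periodsT3 F K) c₀ W₂)
    (x₀ : TSite 3 (periodsT3 F K)) (M X δ : ℝ)
    (hM : ∀ y, ‖WL2.equiv ℂ (fun _ : TSite 3 (periodsT3 F K) => c₀) W₂ u y‖ ≤ M) (hMx : ‖WL2.equiv ℂ (fun _ : TSite 3 (periodsT3 F K) => c₀) W₂ u x₀‖ = M)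
    (hX : 0 ≤ X) (hf : ∀ p, ‖WL2.equiv ℂ (fun _ : Bond 3 (periodsT3 F K) => c₀) W₂ f p‖ ≤ X)
    (heq : covLapSite F n K c₀ V u + ((1 : ℝ) : ℂ) • u = DstarL2 F n K c₀ V f)
    (hδ : 0 ≤ δ) (hℓδ : (F.L : ℝ) ^ (K - n) * δ ≤ θ₀)
    (hδrow : ∀ (y : TSite 3 (periodsT3 F K)) (μ : Fin 3), tdist (periodsT3 F K) x₀ y ≤ 4 * (F.L : ℝ) ^ (K - n) + 1 →
      ‖((bgOfCfg F K V (y, μ) : (Matrix (Fin 2) (Fin 2) ℂ)ˣ) : Matrix (Fin 2) (Fin 2) ℂ) - 1‖ ≤ δ)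
    (hroom : ∀ i, (F.L : ℝ) ^ (K - n) + 1 ≤ (periodsT3 F K i : ℝ)) :
    M ≤ (2 * (8 * Ch + 1) ^ 3 * Real.sqrt C_A + 1) * X := by
  classical
  set ℓ : ℝ := (F.L : ℝ) ^ (K - n) with hℓ
  have hL1 : (1 : ℝ) < (F.L : ℝ) := by exact_mod_cast F.hL.2
  have hℓpos : 0 < ℓ := pow_pos (lt_trans zero_lt_one hL1) _
  have hM0 : 0 ≤ M := hMx ▸ norm_nonneg _
  have heq' : covLapSite F n K c₀ V u + u = DstarL2 F n K c₀ V f := by simpa only [Complex.ofReal_one, one_smul] using heq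
  -- the Hölder letter at `(Mu, Mf, Mq) := (M, X, M)`
  have hHö := hH V u u f x₀ M X M δ hM0 hX hM0 hδ hℓδ heq' (fun y _ => hM y) (fun y μ _ => hf (y, μ)) (fun y _ => hM y) hδrow
  have hAg := hA V u f X heq hf x₀
  -- the radius `r = ℓ / a²`, `a = 8Ch + 1`
  set a : ℝ := 8 * Ch + 1 with ha
  have ha1 : 1 ≤ a := by rw [ha]; linarith
  have ha0 : 0 < a := lt_of_lt_of_le zero_lt_one ha1
  set r : ℝ := ℓ / a ^ 2 with hr
  have hr0 : 0 ≤ r := by positivity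
  have hrℓ : r ≤ ℓ := by
    rw [hr, div_le_iff₀ (by positivity)]
    have : (1 : ℝ) ≤ a ^ 2 := one_le_pow₀ ha1
    nlinarith
  -- the lower bound on the small ball
  set m₀ : ℝ := M - (2 * M + X) / 8 with hm₀
  have hlow : ∀ y, tdist (periodsT3 F K) x₀ y ≤ r → m₀ ≤ ‖WL2.equiv ℂ (fun _ : TSite 3 (periodsT3 F K) => c₀) W₂ u y‖ := by
    intro y hy
    have h1 := hHö y (hy.trans hrℓ)
    have h2 : (tdist (periodsT3 F K) x₀ y / ℓ) ^ ((1 : ℝ) / 2) ≤ 1 / a := by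
      have hq : tdist (periodsT3 F K) x₀ y / ℓ ≤ (1 / a) ^ 2 := by
        rw [div_le_iff₀ hℓpos]
        calc tdist (periodsT3 F K) x₀ y ≤ r := hy
          _ = (1 / a) ^ 2 * ℓ := by rw [hr]; field_simp
      calc (tdist (periodsT3 F K) x₀ y / ℓ) ^ ((1 : ℝ) / 2) ≤ ((1 / a) ^ 2) ^ ((1 : ℝ) / 2) :=
            Real.rpow_le_rpow (div_nonneg (tdist_nonneg _ _ _) hℓpos.le) hq (by norm_num)
        _ = 1 / a := by rw [← Real.sqrt_eq_rpow, Real.sqrt_sq (by positivity)]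
    have h3 : ‖WL2.equiv ℂ (fun _ : TSite 3 (periodsT3 F K) => c₀) W₂ u y - WL2.equiv ℂ (fun _ : TSite 3 (periodsT3 F K) => c₀) W₂ u x₀‖ ≤ (2 * M + X) / 8 := by
      have hCa : Ch / a ≤ 1 / 8 := by rw [div_le_iff₀ ha0, ha]; linarith
      have h2MX : 0 ≤ 2 * M + X := by positivity
      calc _ ≤ Ch * (M + X + M) * (tdist (periodsT3 F K) x₀ y / ℓ) ^ ((1 : ℝ) / 2) := h1
        _ ≤ Ch * (M + X + M) * (1 / a) := mul_le_mul_of_nonneg_left h2 (by positivity)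
        _ = (2 * M + X) * (Ch / a) := by ring
        _ ≤ (2 * M + X) * (1 / 8) := mul_le_mul_of_nonneg_left hCa h2MX
        _ = (2 * M + X) / 8 := by ring
    have h4 : ‖WL2.equiv ℂ (fun _ : TSite 3 (periodsT3 F K) => c₀) W₂ u x₀‖ - ‖WL2.equiv ℂ (fun _ : TSite 3 (periodsT3 F K) => c₀) W₂ u y‖
        ≤ ‖WL2.equiv ℂ (fun _ : TSite 3 (periodsT3 F K) => c₀) W₂ u y - WL2.equiv ℂ (fun _ : TSite 3 (periodsT3 F K) => c₀) W₂ u x₀‖ := by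
      calc _ ≤ ‖WL2.equiv ℂ (fun _ : TSite 3 (periodsT3 F K) => c₀) W₂ u x₀ - WL2.equiv ℂ (fun _ : TSite 3 (periodsT3 F K) => c₀) W₂ u y‖ := norm_sub_norm_le _ _
        _ = _ := norm_sub_rev _ _
    rw [hm₀, ← hMx]
    linarith
  -- the small ball and its `L²` mass
  set S := Finset.univ.filter (fun y : TSite 3 (periodsT3 F K) => tdist (periodsT3 F K) x₀ y ≤ r) with hS
  have hSsub : S ⊆ Finset.univ.filter (fun y : TSite 3 (periodsT3 F K) => tdist (periodsT3 F K) x₀ y ≤ ℓ) :=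
    Finset.monotone_filter_right _ fun y _ hy => hy.trans hrℓ
  have hsumS : ∑ y ∈ S, ‖WL2.equiv ℂ (fun _ : TSite 3 (periodsT3 F K) => c₀) W₂ u y‖ ^ 2 ≤ C_A * ℓ ^ 3 * X ^ 2 :=
    (Finset.sum_le_sum_of_subset_of_nonneg hSsub fun _ _ _ => sq_nonneg _).trans hAg
  have hcard : r ^ 3 ≤ (S.card : ℝ) := pow_le_card_ball x₀ hr0 fun i => by linarith [hroom i]
  have hA3 : 0 ≤ a ^ 3 * Real.sqrt C_A * X := by positivity
  by_cases hm : m₀ ≤ 0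
  · -- `6M ≤ X`
    have h6 : M ≤ X / 6 := by rw [hm₀] at hm; linarith
    have : X / 6 ≤ (2 * (8 * Ch + 1) ^ 3 * Real.sqrt C_A + 1) * X := by rw [← ha]; linarith [hA3]
    exact h6.trans this
  · rw [not_le] at hm
    have h5 : (S.card : ℝ) * m₀ ^ 2 ≤ ∑ y ∈ S, ‖WL2.equiv ℂ (fun _ : TSite 3 (periodsT3 F K) => c₀) W₂ u y‖ ^ 2 := by
      have := Finset.card_nsmul_le_sum S (fun y => ‖WL2.equiv ℂ (fun _ : TSite 3 (periodsT3 F K) => c₀) W₂ u y‖ ^ 2) (m₀ ^ 2)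
        fun y hy => pow_le_pow_left₀ hm.le (hlow y (Finset.mem_filter.mp hy).2) 2
      rwa [nsmul_eq_mul] at this
    have h6 : r ^ 3 * m₀ ^ 2 ≤ C_A * ℓ ^ 3 * X ^ 2 := (mul_le_mul_of_nonneg_right hcard (sq_nonneg _)).trans (h5.trans hsumS)
    have h7 : m₀ ^ 2 ≤ (a ^ 3 * Real.sqrt C_A * X) ^ 2 := by
      have hr3 : r ^ 3 = ℓ ^ 3 / a ^ 6 := by rw [hr, div_pow]; ring
      rw [hr3, div_mul_eq_mul_div, div_le_iff₀ (by positivity)] at h6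
      have hℓ3 : 0 < ℓ ^ 3 := by positivity
      have h6' : ℓ ^ 3 * m₀ ^ 2 ≤ ℓ ^ 3 * (a ^ 6 * C_A * X ^ 2) := by linarith [h6]
      have h8 := le_of_mul_le_mul_left h6' hℓ3
      calc m₀ ^ 2 ≤ a ^ 6 * C_A * X ^ 2 := h8
        _ = (a ^ 3 * Real.sqrt C_A * X) ^ 2 := by rw [mul_pow, mul_pow, Real.sq_sqrt hCA, ← pow_mul]
    have h8 : m₀ ≤ a ^ 3 * Real.sqrt C_A * X := by
      have := Real.sqrt_le_sqrt h7
      rwa [Real.sqrt_sq hm.le, Real.sqrt_sq hA3] at this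
    have hMm : M = (8 * m₀ + X) / 6 := by rw [hm₀]; ring
    rw [hMm]
    linarith [h8, hX, hA3]

end Bootstrap

/-! ## §3 The lift-and-gauge package -/

section Lift

variable (F : T3Family) (n K : ℕ) (c₀ : ℝ) [Fact (0 < c₀)]

/-- ★★ **THE LIFT-AND-GAUGE PACKAGE** (LOCATE c1d4da4e §1 (a)(b)).  For `RegPr F n K ε₀ U₀` (`0 ≤ ε₀`), a solution `(w, x)` of `Δ^η_{U₀}w + 1•w = D*_{U₀}x` and any site `y₀`: on the
`L³`-fold cover `F.cover 3` there are a background `Ṽ` (the lift `U₀ ∘ π♭` in the cover's axial gauge at a lift `ct` of `y₀`), fields `ũ := Φ(w∘π)`, `f̃ := Ψ(x∘π♭)` solving the same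
equation at `Ṽ` (✓`covLapSite_cover`, ✓`DstarL2_cover'`, ✓`memberEquation_gaugeAct`), the centre `x̃₀ = ẽ ct`, such that every pointwise norm of `ũ` (resp. `f̃`) is a pointwise norm
of `w` (resp. `x`) (✓`exists_adIsometries_pointwise`), `‖ũ(x̃₀)‖ = ‖w(y₀)‖`, and the δ-row `‖Ṽ(z, μ) − 1‖ ≤ 48ε₀η` holds on the `12ℓ+4` ball about `x̃₀`
(✓`norm_bgOfCfg_gaugeAct_axialT_sub_one_le_cover`).
[cite: Balaban1985BackgroundPropagators, (3.35) p.396, p.393, (3.23) p.394; Balaban1985Averaging, pp.24-25; Balaban1987RG1, (0.1)-(0.3) pp.251-252] -/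
theorem exists_cover_gauge_lift {ε₀ : ℝ} (hε₀ : 0 ≤ ε₀) (U₀ : GaugeField (F.P K) 0 (Matrix.specialUnitaryGroup (Fin 2) ℂ)) (hreg : RegPr F n K ε₀ U₀)
    (w : SiteL2K ℂ 3 (periodsT3 F K) c₀ W₂) (x : BondL2K ℂ 3 (periodsT3 F K) c₀ W₂)
    (h : covLapSite F n K c₀ U₀ w + ((1 : ℝ) : ℂ) • w = DstarL2 F n K c₀ U₀ x) (y₀ : TSite 3 (periodsT3 F K)) :
    ∃ (V : GaugeField ((F.cover 3).P K) 0 (Matrix.specialUnitaryGroup (Fin 2) ℂ)) (u : SiteL2K ℂ 3 (periodsT3 (F.cover 3) K) c₀ W₂)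
      (f : BondL2K ℂ 3 (periodsT3 (F.cover 3) K) c₀ W₂) (x₀ : TSite 3 (periodsT3 (F.cover 3) K)),
      covLapSite (F.cover 3) n K c₀ V u + ((1 : ℝ) : ℂ) • u = DstarL2 (F.cover 3) n K c₀ V f ∧
      (∀ z : TSite 3 (periodsT3 (F.cover 3) K), ∃ y : TSite 3 (periodsT3 F K),
        ‖WL2.equiv ℂ (fun _ : TSite 3 (periodsT3 (F.cover 3) K) => c₀) W₂ u z‖ = ‖WL2.equiv ℂ (fun _ : TSite 3 (periodsT3 F K) => c₀) W₂ w y‖) ∧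
      ‖WL2.equiv ℂ (fun _ : TSite 3 (periodsT3 (F.cover 3) K) => c₀) W₂ u x₀‖ = ‖WL2.equiv ℂ (fun _ : TSite 3 (periodsT3 F K) => c₀) W₂ w y₀‖ ∧
      (∀ p : Bond 3 (periodsT3 (F.cover 3) K), ∃ b : Bond 3 (periodsT3 F K),
        ‖WL2.equiv ℂ (fun _ : Bond 3 (periodsT3 (F.cover 3) K) => c₀) W₂ f p‖ = ‖WL2.equiv ℂ (fun _ : Bond 3 (periodsT3 F K) => c₀) W₂ x b‖) ∧
      (∀ (z : TSite 3 (periodsT3 (F.cover 3) K)) (μ : Fin 3), tdist (periodsT3 (F.cover 3) K) x₀ z ≤ 12 * (F.L : ℝ) ^ (K - n) + 4 →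
        ‖((bgOfCfg (F.cover 3) K V (z, μ) : (Matrix (Fin 2) (Fin 2) ℂ)ˣ) : Matrix (Fin 2) (Fin 2) ℂ) - 1‖ ≤ 48 * ε₀ * eta F n K) := by
  classical
  -- the lifted background and a lift of `y₀`
  set Ut : GaugeField ((F.cover 3).P K) 0 (Matrix.specialUnitaryGroup (Fin 2) ℂ) := U₀ ∘ projBond (F.P K) 3 0 with hUt
  obtain ⟨ct, hct⟩ := proj_surjective (F.P K) 3 0 ((siteEquiv F K).symm y₀)
  -- the lifted fields
  set l : Site (F.P K) 0 → Matrix (Fin 2) (Fin 2) ℂ := (toL2S F K c₀).symm w with hl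
  set Xf : PBond (F.P K) 0 → Matrix (Fin 2) (Fin 2) ℂ := (toL2 F K c₀).symm x with hXf
  have hwl : toL2S F K c₀ l = w := (toL2S F K c₀).apply_symm_apply w
  have hxX : toL2 F K c₀ Xf = x := (toL2 F K c₀).apply_symm_apply x
  set ut : SiteL2K ℂ 3 (periodsT3 (F.cover 3) K) c₀ W₂ := toL2S (F.cover 3) K c₀ (l ∘ proj (F.P K) 3 0) with hut
  set xt : BondL2K ℂ 3 (periodsT3 (F.cover 3) K) c₀ W₂ := toL2 (F.cover 3) K c₀ (Xf ∘ projBond (F.P K) 3 0) with hxt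
  -- the lifted equation
  have key : (toL2S F K c₀).symm (covLapSite F n K c₀ U₀ w) + ((1 : ℝ) : ℂ) • l = (toL2S F K c₀).symm (DstarL2 F n K c₀ U₀ x) := by
    rw [hl, ← map_smul, ← map_add, h]
  have hteq : covLapSite (F.cover 3) n K c₀ Ut ut + ((1 : ℝ) : ℂ) • ut = DstarL2 (F.cover 3) n K c₀ Ut xt := by
    have hΔ := covLapSite_cover F 3 n K c₀ U₀ l
    rw [hwl] at hΔ
    have hD := DstarL2_cover' F 3 n K c₀ U₀ Xf
    rw [hxX] at hD
    have hsm : ((1 : ℝ) : ℂ) • ut = toL2S (F.cover 3) K c₀ ((((1 : ℝ) : ℂ) • l) ∘ proj (F.P K) 3 0) := by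
      rw [hut, ← map_smul]; rfl
    rw [hsm, hUt, hut, hΔ, hxt, hD, ← map_add]
    congr 1
    funext z
    simpa only [Pi.add_apply, Function.comp_apply] using congr_fun key (proj (F.P K) 3 0 z)
  -- the pointwise values of the lifts
  have hut_apply : ∀ z : TSite 3 (periodsT3 (F.cover 3) K),
      WL2.equiv ℂ (fun _ : TSite 3 (periodsT3 (F.cover 3) K) => c₀) W₂ ut z
        = WL2.equiv ℂ (fun _ : TSite 3 (periodsT3 F K) => c₀) W₂ w (siteEquiv F K (proj (F.P K) 3 0 ((siteEquiv (F.cover 3) K).symm z))) := by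
    intro z
    rw [hut, toL2S_apply, Function.comp_apply, ← hwl, toL2S_apply, Equiv.symm_apply_apply]
  have hxt_apply : ∀ p : Bond 3 (periodsT3 (F.cover 3) K),
      WL2.equiv ℂ (fun _ : Bond 3 (periodsT3 (F.cover 3) K) => c₀) W₂ xt p
        = WL2.equiv ℂ (fun _ : Bond 3 (periodsT3 F K) => c₀) W₂ x (bondEquiv F K (projBond (F.P K) 3 0 ((bondEquiv (F.cover 3) K).symm p))) := by
    intro p
    rw [hxt, toL2_apply, Function.comp_apply, ← hxX, toL2_apply, Equiv.symm_apply_apply]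
  -- the local gauge at `ct`
  set σ : GaugeTransf ((F.cover 3).P K) 0 (Matrix.specialUnitaryGroup (Fin 2) ℂ) := axialT Ut ct with hσ
  obtain ⟨Φ, Ψ, -, -, hΦpt, hΨpt, hU⟩ := exists_adIsometries_pointwise (F.cover 3) n K c₀ σ
  obtain ⟨-, hDstar, hΔc, -, -, -⟩ := hU Ut
  have hgeq := memberEquation_gaugeAct (F.cover 3) n K c₀ σ Ut Φ Ψ hDstar hΔc hteq
  rw [map_smul] at hgeq
  refine ⟨GaugeField.gaugeAct σ Ut, Φ ut, Ψ xt, siteEquiv (F.cover 3) K ct, hgeq,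
    fun z => ⟨siteEquiv F K (proj (F.P K) 3 0 ((siteEquiv (F.cover 3) K).symm z)), ?_⟩, ?_,
    fun p => ⟨bondEquiv F K (projBond (F.P K) 3 0 ((bondEquiv (F.cover 3) K).symm p)), ?_⟩, fun z μ hz => ?_⟩
  · rw [hΦpt, hut_apply]
  · rw [hΦpt, hut_apply, Equiv.symm_apply_apply, hct, Equiv.apply_symm_apply]
  · rw [hΨpt, hxt_apply]
  · rw [hσ, hUt]
    exact norm_bgOfCfg_gaugeAct_axialT_sub_one_le_cover F n K hε₀ U₀ hreg ct z μ hz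

end Lift

/-! ## §4 ★★★ The DOOR: `hWsup ⟸ hHlocV + (A-ROW)` -/

/-- ★★★ **THE DOOR `hWsup ⟸ hHlocV + (A-ROW)`** (★CHAIR WORD №60 (4), №62; LOCATE c1d4da4e §1).  With the consumer's free reals `Ch θ₀` of the curved interior η-½-Hölder letter `hHlocV`
(px19 g16 text 857ccd79b0071bdc, VERBATIM) and `C_A` of the Agmon `L²` row `hArow` (cst-p1 g38 (A-ROW), LOCATE c1d4da4e §2), and `0 ≤ Ch`, `0 < θ₀`, `0 ≤ C_A`:
**`∃ Cw θw, 0 ≤ Cw ∧ 0 < θw ∧ ⟨hWsup Cw θw⟩`** (px19 g16 text a03f6c184c689677 VERBATIM), the witnesses being **`Cw := 2(8Ch+1)³√C_A + 1`, `θw := θ₀∕48`** (first line of the proof) — chosen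
BEFORE the member `(F, n, K)`: K-free.  PROOF: §3 at the argmax `y₀` of `‖w‖`, then §2 on the cover member `F.cover 3` (room ✓`room_cover_three`; `ℓ·48ε₀η = 48ε₀ ≤ θ₀`).
[cite: Balaban1985BackgroundPropagators, Thm 3.1 (3.46) p.398, p.399 L1-3, (3.35) p.396; Balaban1984PropagatorsII, Lemma 2.1 (2.61)-(2.63) p.234; Balaban1987RG1, (0.1)-(0.3) pp.251-252] -/
theorem hWsup_of_hHlocV (Ch θ₀ C_A : ℝ) (hCh : 0 ≤ Ch) (hθ₀ : 0 < θ₀) (hCA : 0 ≤ C_A)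
    (hHlocV : ∀ (F : T3Family) (n K : ℕ) (c₀ : ℝ) [Fact (0 < c₀)] (V : GaugeField (F.P K) 0 (Matrix.specialUnitaryGroup (Fin 2) ℂ))
      (u q : SiteL2K ℂ 3 (periodsT3 F K) c₀ W₂) (f : BondL2K ℂ 3 (periodsT3 F K) c₀ W₂) (x : TSite 3 (periodsT3 F K)) (Mu Mf Mq δ : ℝ),
      0 ≤ Mu → 0 ≤ Mf → 0 ≤ Mq → 0 ≤ δ → (F.L : ℝ) ^ (K - n) * δ ≤ θ₀ →
      covLapSite F n K c₀ V u + q = DstarL2 F n K c₀ V f →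
      (∀ y, tdist (periodsT3 F K) x y ≤ 4 * (F.L : ℝ) ^ (K - n) + 1 → ‖WL2.equiv ℂ (fun _ : TSite 3 (periodsT3 F K) => c₀) W₂ u y‖ ≤ Mu) →
      (∀ (y : TSite 3 (periodsT3 F K)) (μ : Fin 3), tdist (periodsT3 F K) x y ≤ 4 * (F.L : ℝ) ^ (K - n) + 1 →
        ‖WL2.equiv ℂ (fun _ : Bond 3 (periodsT3 F K) => c₀) W₂ f (y, μ)‖ ≤ Mf) →
      (∀ y, tdist (periodsT3 F K) x y ≤ 4 * (F.L : ℝ) ^ (K - n) + 1 → ‖WL2.equiv ℂ (fun _ : TSite 3 (periodsT3 F K) => c₀) W₂ q y‖ ≤ Mq) →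
      (∀ (y : TSite 3 (periodsT3 F K)) (μ : Fin 3), tdist (periodsT3 F K) x y ≤ 4 * (F.L : ℝ) ^ (K - n) + 1 →
        ‖((bgOfCfg F K V (y, μ) : (Matrix (Fin 2) (Fin 2) ℂ)ˣ) : Matrix (Fin 2) (Fin 2) ℂ) - 1‖ ≤ δ) →
      ∀ x' : TSite 3 (periodsT3 F K), tdist (periodsT3 F K) x x' ≤ (F.L : ℝ) ^ (K - n) →
        ‖WL2.equiv ℂ (fun _ : TSite 3 (periodsT3 F K) => c₀) W₂ u x' - WL2.equiv ℂ (fun _ : TSite 3 (periodsT3 F K) => c₀) W₂ u x‖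
          ≤ Ch * (Mu + Mf + Mq) * (tdist (periodsT3 F K) x x' / ((F.L : ℝ) ^ (K - n))) ^ ((1 : ℝ) / 2))
    (hArow : ∀ (F : T3Family) (n K : ℕ) (c₀ : ℝ) [Fact (0 < c₀)] (V : GaugeField (F.P K) 0 (Matrix.specialUnitaryGroup (Fin 2) ℂ))
      (w : SiteL2K ℂ 3 (periodsT3 F K) c₀ W₂) (x : BondL2K ℂ 3 (periodsT3 F K) c₀ W₂) (X : ℝ),
      covLapSite F n K c₀ V w + ((1 : ℝ) : ℂ) • w = DstarL2 F n K c₀ V x →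
      (∀ b, ‖WL2.equiv ℂ (fun _ : Bond 3 (periodsT3 F K) => c₀) W₂ x b‖ ≤ X) →
      ∀ y₀ : TSite 3 (periodsT3 F K),
        ∑ y ∈ Finset.univ.filter (fun y => tdist (periodsT3 F K) y₀ y ≤ (F.L : ℝ) ^ (K - n)),
          ‖WL2.equiv ℂ (fun _ : TSite 3 (periodsT3 F K) => c₀) W₂ w y‖ ^ 2 ≤ C_A * ((F.L : ℝ) ^ (K - n)) ^ 3 * X ^ 2) :
    ∃ Cw θw : ℝ, 0 ≤ Cw ∧ 0 < θw ∧
      ∀ (F : T3Family) (n K : ℕ) (c₀ : ℝ) [Fact (0 < c₀)] (ε₀ : ℝ) (U₀ : GaugeField (F.P K) 0 (Matrix.specialUnitaryGroup (Fin 2) ℂ)),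
      0 ≤ ε₀ → ε₀ ≤ θw → RegPr F n K ε₀ U₀ →
      ∀ (w : SiteL2K ℂ 3 (periodsT3 F K) c₀ W₂) (x : BondL2K ℂ 3 (periodsT3 F K) c₀ W₂) (X : ℝ), 0 ≤ X →
      covLapSite F n K c₀ U₀ w + ((1 : ℝ) : ℂ) • w = DstarL2 F n K c₀ U₀ x →
      (∀ b : Bond 3 (periodsT3 F K), ‖WL2.equiv ℂ (fun _ : Bond 3 (periodsT3 F K) => c₀) W₂ x b‖ ≤ X) →
      ∀ y : TSite 3 (periodsT3 F K), ‖WL2.equiv ℂ (fun _ : TSite 3 (periodsT3 F K) => c₀) W₂ w y‖ ≤ Cw * X := by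
  refine ⟨2 * (8 * Ch + 1) ^ 3 * Real.sqrt C_A + 1, θ₀ / 48, by positivity, by positivity, ?_⟩
  intro F n K c₀ _ ε₀ U₀ hε₀ hεθ hreg w x X hX h hx y
  classical
  -- the argmax of `‖w‖`
  obtain ⟨y₀, -, hy₀⟩ := Finset.exists_max_image Finset.univ
    (fun y : TSite 3 (periodsT3 F K) => ‖WL2.equiv ℂ (fun _ : TSite 3 (periodsT3 F K) => c₀) W₂ w y‖) ⟨y, Finset.mem_univ _⟩
  set M : ℝ := ‖WL2.equiv ℂ (fun _ : TSite 3 (periodsT3 F K) => c₀) W₂ w y₀‖ with hMdef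
  have hwM : ∀ y', ‖WL2.equiv ℂ (fun _ : TSite 3 (periodsT3 F K) => c₀) W₂ w y'‖ ≤ M := fun y' => hy₀ y' (Finset.mem_univ _)
  refine (hwM y).trans ?_
  obtain ⟨V, u, f, x₀, heq, hu, hux₀, hf, hδ⟩ := exists_cover_gauge_lift F n K c₀ hε₀ U₀ hreg w x h y₀
  have hL1 : (1 : ℝ) < (F.L : ℝ) := by exact_mod_cast F.hL.2
  have hL0 : (0 : ℝ) < (F.L : ℝ) := lt_trans zero_lt_one hL1
  have hℓ0 : (0 : ℝ) ≤ (F.L : ℝ) ^ (K - n) := (pow_pos hL0 _).le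
  have hη : 0 < eta F n K := eta_pos F n K
  have hℓη : ((F.cover 3).L : ℝ) ^ (K - n) * eta F n K = 1 := by
    show (F.L : ℝ) ^ (K - n) * eta F n K = 1
    unfold eta; rw [← mul_pow, mul_inv_cancel₀ hL0.ne', one_pow]
  have hℓδ : ((F.cover 3).L : ℝ) ^ (K - n) * (48 * ε₀ * eta F n K) ≤ θ₀ := by
    calc ((F.cover 3).L : ℝ) ^ (K - n) * (48 * ε₀ * eta F n K) = 48 * ε₀ * (((F.cover 3).L : ℝ) ^ (K - n) * eta F n K) := by ring
      _ = 48 * ε₀ := by rw [hℓη, mul_one]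
      _ ≤ θ₀ := by linarith
  have hroom : ∀ i, ((F.cover 3).L : ℝ) ^ (K - n) + 1 ≤ (periodsT3 (F.cover 3) K i : ℝ) := by
    intro i
    have h1 := room_cover_three F n K
    have h2 : (F.cover 3).L ^ (K - n) + 1 ≤ periodsT3 (F.cover 3) K i := by
      show (F.cover 3).L ^ (K - n) + 1 ≤ ((F.cover 3).P K).sitesPerDir 0
      omega
    exact_mod_cast h2
  exact sup_le_of_holder_agmon (F.cover 3) n K c₀ Ch θ₀ C_A hCh hCA (hHlocV (F.cover 3) n K c₀) (hArow (F.cover 3) n K c₀) V u f x₀ M X (48 * ε₀ * eta F n K)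
    (fun z => by obtain ⟨y', hy'⟩ := hu z; rw [hy']; exact hwM y') hux₀ hX (fun p => by obtain ⟨b, hb⟩ := hf p; rw [hb]; exact hx b) heq
    (by positivity) hℓδ (fun z μ hz => hδ z μ (hz.trans (by show (4 : ℝ) * (F.L : ℝ) ^ (K - n) + 1 ≤ 12 * (F.L : ℝ) ^ (K - n) + 4; nlinarith))) hroom

end Summit.QuantumFields.YangMills.Theorems.Prop7MassiveDivergenceSupDoor

end
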